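import Mathlib
import Literature.Analysis.ValidatedNumerics.ConeSeriesRegularity
import Literature.Analysis.ValidatedNumerics.ConeSeriesSymmetry
import Literature.MathematicalPhysics.MHD.GradShafranovSqrtOperator
import HarnessLib

/-!
# From the cone-algebra certificate to the Grad–Shafranov operator: the Liouville step

Topic `Literature/Analysis/ValidatedNumerics`.  Final composition of the certnum F2 (B-SL) chain.  A zero
`x ∈ W = ℓ¹_ϱ(ζ^aζ̄^b)` of the semilinear map `x − Δ_D⁻¹(v x + Σ_{k≤m} c_k x^k) − g` (harmonic datum `g`,
symmetric = real data) represents the real function `ũ = eval x` on the disk; through a local analytic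
inverse `Ψ` of the certificate's conformal pre-map `Φ` it gives `w(R, Z) := Re ũ(Ψ(R + iZ))` on the physical
chart, and (`ConeSeriesRegularity.laplacian_eval_comp_chart`) `Δw = V₀ w + Σ C_k w^k` at the point when the
coefficient series evaluate to the chart's coefficients times the conformal factor.  With `V₀ = ¾R⁻²` the
pointwise Liouville identity `Δ*(√R·w) = √R(w_RR + w_ZZ − ¾R⁻²w)`
(`GradShafranovSqrt.gsOperator_sqrt_mul_eq_iff`, p532316) turns this into

  **`Δ*(√R · w)(R, Z) = √R · Σ_{k≤m} C_k · w(R,Z)^k`**   (`gsOperator_sqrt_mul_evalChart`),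

i.e. `U := √R·w` satisfies the Grad–Shafranov-type equation `Δ*U = f(R, U)` with
`f(R, U) = Σ_k C_k R^{(1−k)/2} U^k` — for the (B-SL) profiles `C_k = (a_k R² + b_k) R^{(k−1)/2}` this is
`Σ_k (a_k R² + b_k) U^k` (the client's bookkeeping).  Ingredients typed elsewhere and only assembled here:
`C²`-regularity of `eval x` (`contDiffAt_eval`), real-valuedness for symmetric data (`im_eval_eq_zero`),
Mathlib's `Δ` through a real-linear map (`ContDiffAt.laplacian_CLM_comp_left`), curried second derivatives
(`ConformalLaplacian.laplacian_curried_eq`, p550475).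

## Sources

[ArioliKoch2019] §4 Lemma 4.1 / eq. (1.4) (the disk fixed-point problem), Lemma 4.3 (symmetry);
[Everitt2005SLCatalogue] §7 (Liouville transformation; as cited by `GradShafranovSqrtOperator.lean`);
[AsmarGrafakos2018] Thm. 6.1.10 (conformal invariance of `Δ`; as cited by `LaplacianConformalPullback.lean`).

## What is NOT covered

The certificate's numbers and the identifications `v(Ψ p) = |Φ′|²·¾R⁻²`, `c_k(Ψ p) = |Φ′|² C_k` (hypotheses:
they are what the producer's ball objects `V`, `C_k` encode); global statements on `Ω_W` (everything is
pointwise at a chart point with `R > 0`); float model.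

## Provenance

AI-produced formalisation (cell certnum, seat certnum-ode-2, 2026-08-27).
-/

set_option autoImplicit false

open scoped BigOperators Topology
open Complex Filter Set Metric InnerProductSpace
open scoped Laplacian

noncomputable section

namespace Literature.Analysis.ValidatedNumerics

namespace ConeEval

open WeightedSeq WienerAlgebra ConeMonomial ConeSemilinear
open Literature.MathematicalPhysics.MHD

variable {ϱ : ℝ}

/-- The represented function in the physical chart, as a real curried function of `(R, Z)`:
`w(R, Z) = Re (eval x)(Ψ(R + iZ))`. [cite: ArioliKoch2019, §3 eq. (3.3) (real-valued functions of B_ρ)] -/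
def evalChart (hϱ : 1 ≤ ϱ) (x : Wiener (coneSubmultWeight hϱ)) (Ψ : ℂ → ℂ) (r z : ℝ) : ℝ :=
  (eval hϱ x (Ψ ((r : ℂ) + (z : ℂ) * I))).re

/-- In complex coordinates the curried chart function is `Re ∘ (eval x) ∘ Ψ`.
[cite: ArioliKoch2019, §3 eq. (3.3)] -/
theorem evalChart_curried_eq (hϱ : 1 ≤ ϱ) (x : Wiener (coneSubmultWeight hϱ)) (Ψ : ℂ → ℂ) :
    (fun q : ℂ => evalChart hϱ x Ψ q.re q.im) = Complex.reCLM ∘ (eval hϱ x ∘ Ψ) := by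
  funext q
  simp only [evalChart, Function.comp_apply, Complex.reCLM_apply, Complex.re_add_im]

/-- **Slot regularity from `C²`:** if `G : ℂ → ℝ` is `C²` near `R + iZ` then the slice `s ↦ G(s + iZ)` is
differentiable near `R` and its derivative is differentiable at `R` (the hypotheses of
`GradShafranovSqrt.gsOperator_sqrt_mul_eq_iff`). [folklore] -/
private theorem slice_regular {G : ℂ → ℝ} {R Z : ℝ}
    (hG : ∀ᶠ q in 𝓝 ((R : ℂ) + (Z : ℂ) * I), ContDiffAt ℝ 2 G q) :
    (∀ᶠ r in 𝓝 R, DifferentiableAt ℝ (fun s : ℝ => G ((s : ℂ) + (Z : ℂ) * I)) r) ∧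
      DifferentiableAt ℝ (deriv fun s : ℝ => G ((s : ℂ) + (Z : ℂ) * I)) R := by
  set ℓ : ℝ → ℂ := fun s => (s : ℂ) + (Z : ℂ) * I with hℓ
  have hℓc : ContDiff ℝ 2 ℓ := (Complex.ofRealCLM.contDiff.add contDiff_const)
  have hℓt : Tendsto ℓ (𝓝 R) (𝓝 (ℓ R)) := hℓc.continuous.continuousAt
  -- C² of the slice near R
  have hs : ∀ᶠ r in 𝓝 R, ContDiffAt ℝ 2 (fun s : ℝ => G (ℓ s)) r := by
    filter_upwards [hℓt.eventually hG] with r hr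
    exact hr.comp r hℓc.contDiffAt
  refine ⟨hs.mono fun r hr => hr.differentiableAt (by norm_num), ?_⟩
  have hR : ContDiffAt ℝ 2 (fun s : ℝ => G (ℓ s)) R := hs.self_of_nhds
  have h1 : ContDiffAt ℝ 1 (fderiv ℝ (fun s : ℝ => G (ℓ s))) R :=
    hR.fderiv_right (m := 1) (by norm_num)
  have h2 : DifferentiableAt ℝ (fderiv ℝ (fun s : ℝ => G (ℓ s))) R := h1.differentiableAt (by norm_num)
  have e : (deriv fun s : ℝ => G (ℓ s)) = fun s => (fderiv ℝ (fun s : ℝ => G (ℓ s)) s) 1 := by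
    funext s; rfl
  rw [e]
  exact ((ContinuousLinearMap.apply ℝ ℝ (1 : ℝ)).differentiableAt).comp R h2

/-- **The Grad–Shafranov operator of the certificate's zero.**  Let `ϱ > 1`; let `x ∈ W` be a zero of the
(B-SL) map `x − Δ_D⁻¹(v x + Σ_{k≤m} c_k x^k) − g` with harmonic datum `g` and SYMMETRIC (= real) `x`; let
`Φ` be the pre-map and `Ψ` a local analytic inverse at `p = R + iZ` (`R > 0`, `|Ψ p| < 1`), and suppose
the coefficient series evaluate at `Ψ p` to the conformal factor times the chart coefficients,
`v(Ψ p) = |Φ′(Ψ p)|²·¾R⁻²`, `c_k(Ψ p) = |Φ′(Ψ p)|²·C_k` (`C_k` real).  Then the real chart function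
`w(R,Z) = Re (eval x)(Ψ(R+iZ))` satisfies
`Δ*(√R·w)(R, Z) = √R · Σ_{k≤m} C_k · w(R,Z)^k`.
[cite: Everitt2005SLCatalogue, §7 (Liouville transformation Δ*(√R w) = √R(Δw − ¾R⁻²w)); ArioliKoch2019 §4 Lemma 4.1] -/
theorem gsOperator_sqrt_mul_evalChart (hϱ1 : 1 < ϱ) {v g x : Wiener (coneSubmultWeight hϱ1.le)}
    {c : ℕ → Wiener (coneSubmultWeight hϱ1.le)} {m : ℕ}
    (hx : Literature.Analysis.Calculus.PolynomialNonlinearity.semilinMap (dirInv hϱ1.le) v c m g x = 0)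
    (hg : ∀ n : Fin 2 →₀ ℕ, cf g n ≠ 0 → n 0 = 0 ∨ n 1 = 0) (hxs : IsSymm x)
    {Φ Ψ : ℂ → ℂ} {R Z : ℝ} (hR : 0 < R)
    (hΨ : AnalyticAt ℂ Ψ ((R : ℂ) + (Z : ℂ) * I)) (hΨp : ‖Ψ ((R : ℂ) + (Z : ℂ) * I)‖ < 1)
    (hΦ : DifferentiableAt ℂ Φ (Ψ ((R : ℂ) + (Z : ℂ) * I)))
    (hinv : ∀ᶠ q in 𝓝 ((R : ℂ) + (Z : ℂ) * I), Φ (Ψ q) = q)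
    {C : ℕ → ℝ}
    (hv : eval hϱ1.le v (Ψ ((R : ℂ) + (Z : ℂ) * I))
      = (‖deriv Φ (Ψ ((R : ℂ) + (Z : ℂ) * I))‖ ^ 2 : ℝ) * (((3 / 4 * (R ^ 2)⁻¹ : ℝ)) : ℂ))
    (hc : ∀ k, eval hϱ1.le (c k) (Ψ ((R : ℂ) + (Z : ℂ) * I))
      = (‖deriv Φ (Ψ ((R : ℂ) + (Z : ℂ) * I))‖ ^ 2 : ℝ) * ((C k : ℝ) : ℂ)) :
    GradShafranov.gsOperator (fun r z => Real.sqrt r * evalChart hϱ1.le x Ψ r z) R Z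
      = Real.sqrt R * ∑ k ∈ Finset.range (m + 1), C k * (evalChart hϱ1.le x Ψ R Z) ^ k := by
  have hϱ : 1 ≤ ϱ := hϱ1.le
  set p : ℂ := (R : ℂ) + (Z : ℂ) * I with hp
  -- (1) C² of `eval x ∘ Ψ` near p
  have hΨev : ∀ᶠ q in 𝓝 p, AnalyticAt ℂ Ψ q := hΨ.eventually_analyticAt
  have hballev : ∀ᶠ q in 𝓝 p, ‖Ψ q‖ < 1 :=
    hΨ.continuousAt.preimage_mem_nhds ((isOpen_lt continuous_norm continuous_const).mem_nhds hΨp)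
  have hC2ev : ∀ᶠ q in 𝓝 p, ContDiffAt ℝ 2 (Complex.reCLM ∘ (eval hϱ x ∘ Ψ)) q := by
    filter_upwards [hΨev, hballev] with q hq1 hq2
    exact Complex.reCLM.contDiff.contDiffAt.comp q
      ((contDiffAt_eval hϱ1 x hq2).comp q ((hq1.contDiffAt (n := 2)).restrict_scalars ℝ))
  have hC2G : ContDiffAt ℝ 2 (eval hϱ x ∘ Ψ) p :=
    (contDiffAt_eval hϱ1 x hΨp).comp p ((hΨ.contDiffAt (n := 2)).restrict_scalars ℝ)
  have hC2 : ContDiffAt ℝ 2 (Complex.reCLM ∘ (eval hϱ x ∘ Ψ)) p := hC2ev.self_of_nhds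
  -- (2) the real value and the complex Laplacian at p
  have hreal : eval hϱ x (Ψ p) = (evalChart hϱ x Ψ R Z : ℂ) := by
    apply Complex.ext
    · simp [evalChart, hp]
    · rw [Complex.ofReal_im]; exact im_eval_eq_zero hϱ hxs _
  have hΔG : Δ (eval hϱ x ∘ Ψ) p
      = (((3 / 4 * (R ^ 2)⁻¹) * evalChart hϱ x Ψ R Z
          + ∑ k ∈ Finset.range (m + 1), C k * (evalChart hϱ x Ψ R Z) ^ k : ℝ) : ℂ) := by
    have h := laplacian_eval_comp_chart hϱ1 hx hg hΨ hΨp hΦ hinv hv hc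
    rw [h, hreal]
    push_cast
    ring
  -- (3) the real Laplacian of the curried chart function = dRR + dZZ
  have hcur : ContDiffAt ℝ 2 (fun q : ℂ => evalChart hϱ x Ψ q.re q.im) p := by
    rw [evalChart_curried_eq]; exact hC2
  have hΔw : GradShafranov.dRR (evalChart hϱ x Ψ) R Z + GradShafranov.dZZ (evalChart hϱ x Ψ) R Z
      = (3 / 4 * (R ^ 2)⁻¹) * evalChart hϱ x Ψ R Z
        + ∑ k ∈ Finset.range (m + 1), C k * (evalChart hϱ x Ψ R Z) ^ k := by
    have h1 := Literature.Analysis.Complex.ConformalLaplacian.laplacian_curried_eq hcur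
    have hre : p.re = R := by simp [hp]
    have him : p.im = Z := by simp [hp]
    rw [hre, him] at h1
    unfold GradShafranov.dRR GradShafranov.dZZ
    rw [← h1, evalChart_curried_eq, hC2G.laplacian_CLM_comp_left, Function.comp_apply, hΔG,
      Complex.reCLM_apply, Complex.ofReal_re]
  -- (4) Liouville
  have hsl := slice_regular (G := Complex.reCLM ∘ (eval hϱ x ∘ Ψ)) (R := R) (Z := Z) hC2ev
  have e_slice : (fun s : ℝ => (Complex.reCLM ∘ (eval hϱ x ∘ Ψ)) ((s : ℂ) + (Z : ℂ) * I))
      = fun s => evalChart hϱ x Ψ s Z := by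
    funext s; simp [evalChart]
  rw [e_slice] at hsl
  have hs : 0 < Real.sqrt R := Real.sqrt_pos.mpr hR
  refine (GradShafranovSqrt.gsOperator_sqrt_mul_eq_iff (w := evalChart hϱ x Ψ)
    (f := Real.sqrt R * ∑ k ∈ Finset.range (m + 1), C k * (evalChart hϱ x Ψ R Z) ^ k)
    hR hsl.1 hsl.2).2 ?_
  rw [hΔw]
  field_simp
  ring

/-- **Grad–Shafranov form with polynomial profiles.**  If the chart coefficients come from the profile
polynomial `f(X, U) = Σ_k (a_k X² + b_k) U^k` of the (B-SL) reduction, i.e.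
`C_k = (a_k R² + b_k) · (√R)^k / √R` (`= (a_k R² + b_k) R^{(k−1)/2}`), then with `U = √R·w`:
`Δ*U(R, Z) = Σ_{k≤m} (a_k R² + b_k) · U(R,Z)^k` — the normalised Grad–Shafranov equation (Freidberg (6.150)
type right-hand side) holds at the chart point for the function represented by the certificate's zero.
[cite: Everitt2005SLCatalogue, §7 (Liouville transformation); ArioliKoch2019 §4 Lemma 4.1] -/
theorem gsOperator_evalChart_profiles (hϱ1 : 1 < ϱ) {v g x : Wiener (coneSubmultWeight hϱ1.le)}
    {c : ℕ → Wiener (coneSubmultWeight hϱ1.le)} {m : ℕ}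
    (hx : Literature.Analysis.Calculus.PolynomialNonlinearity.semilinMap (dirInv hϱ1.le) v c m g x = 0)
    (hg : ∀ n : Fin 2 →₀ ℕ, cf g n ≠ 0 → n 0 = 0 ∨ n 1 = 0) (hxs : IsSymm x)
    {Φ Ψ : ℂ → ℂ} {R Z : ℝ} (hR : 0 < R)
    (hΨ : AnalyticAt ℂ Ψ ((R : ℂ) + (Z : ℂ) * I)) (hΨp : ‖Ψ ((R : ℂ) + (Z : ℂ) * I)‖ < 1)
    (hΦ : DifferentiableAt ℂ Φ (Ψ ((R : ℂ) + (Z : ℂ) * I)))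
    (hinv : ∀ᶠ q in 𝓝 ((R : ℂ) + (Z : ℂ) * I), Φ (Ψ q) = q)
    {C a b : ℕ → ℝ} (hC : ∀ k, C k = (a k * R ^ 2 + b k) * Real.sqrt R ^ k / Real.sqrt R)
    (hv : eval hϱ1.le v (Ψ ((R : ℂ) + (Z : ℂ) * I))
      = (‖deriv Φ (Ψ ((R : ℂ) + (Z : ℂ) * I))‖ ^ 2 : ℝ) * (((3 / 4 * (R ^ 2)⁻¹ : ℝ)) : ℂ))
    (hc : ∀ k, eval hϱ1.le (c k) (Ψ ((R : ℂ) + (Z : ℂ) * I))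
      = (‖deriv Φ (Ψ ((R : ℂ) + (Z : ℂ) * I))‖ ^ 2 : ℝ) * ((C k : ℝ) : ℂ)) :
    GradShafranov.gsOperator (fun r z => Real.sqrt r * evalChart hϱ1.le x Ψ r z) R Z
      = ∑ k ∈ Finset.range (m + 1),
          (a k * R ^ 2 + b k) * (Real.sqrt R * evalChart hϱ1.le x Ψ R Z) ^ k := by
  rw [gsOperator_sqrt_mul_evalChart hϱ1 hx hg hxs hR hΨ hΨp hΦ hinv hv hc, Finset.mul_sum]
  have hs : 0 < Real.sqrt R := Real.sqrt_pos.mpr hR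
  refine Finset.sum_congr rfl fun k _ => ?_
  rw [hC, mul_pow]
  field_simp

end ConeEval

end Literature.Analysis.ValidatedNumerics
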